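import Literature.AlgebraicGeometry.HodgeTheory.HodgeConjectureProductsThreefoldsSmallChowZero
import Literature.AlgebraicGeometry.HodgeTheory.BettiHodgeNumbersKunneth
import Literature.AlgebraicGeometry.Motives.HodgeStructureHodgeClassesFinrank
import Literature.AlgebraicGeometry.Motives.FanoRationallyChainConnected
import HarnessLib

/-!
# `HC(T × T')` for two threefolds, piece by piece: each Künneth piece is killed EITHER by Hodge numbers (Hodge-disjointness) OR by coniveau (`N¹H³ = H³`); `HC(T × T')` for threefolds with `CH₀`
# supported on surfaces and `h^{2,0}(T)h^{2,0}(T') = 0`, for `CH₀` on a surface × `CH₀` on a curve, × a rationally chain connected threefold, × a hypersurface threefold of degree `≤ 4`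
# (Voisin I §7.1.1, §11.3.3 Thm. 11.38–11.40, Lemma 11.41, pp. 285–287, Thm. 11.30; Voisin II Thm. 10.17, Cor. 10.21, Thm. 10.31; Bloch–Srinivas 1983 Thm. 1; Voisin 2013 Lemma 2.1; Deligne Hodge II 1.2.5)

Family `hodge`, lane `lit-hodgefound` (Track 2 foundations library; Layers A1/A4), layer `Literature/AlgebraicGeometry/HodgeTheory`.  THEOREMS ONLY (no definition, no named fact, no instance;
D-0026 net debt `0`).

Two criteria for `HC(T × T')`, `T`, `T'` smooth projective threefolds, are in the tree: the NUMERICAL one of the seat's g33-#1 (`BettiUniverse.hodgeConjectureFor_tensor_threefolds_of_hodgeNumber_mul_eq_zero`: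
`h^{1,0}h'^{2,1} = h^{2,1}h'^{1,0} = h^{2,0}h'^{2,0} = h^{3,0}h'^{3,0} = h^{2,1}h'^{2,1} = 0`) and the CONIVEAU one of `HodgeConjectureProductsThreefoldsSmallChowZero`
(`BettiUniverse.hodgeConjectureFor_tensor_threefolds_of_q_zero_of_h20_zero_of_supportedClasses_three_eq_top`: `q(T) = q(T') = 0`, `h^{2,0}(T') = 0`, `N¹H³ = H³` on both; whence `HC(T × T')` for
`CH₀ ⊗ ℚ` of rank `≤ 1` on both).  Both go through the tree's assembly `BettiUniverse.hodgeConjectureFor_tensor_threefolds_of_kunneth_pieces` on the four reduced Künneth pieces `H¹ ⊗ H'³`,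
`H² ⊗ H'²`, `H³ ⊗ H'¹` of `H⁴(T × T')` and `H³ ⊗ H'³` of `H⁶(T × T')`.  This file MIXES the two mechanisms PIECE BY PIECE (§2): a piece is algebraic if it carries no Hodge class at all
(Hodge-disjoint factors: §1, `dim_ℚ Hdg ≤ h^{c,c}(Hⁱ ⊗ Hʲ) = Σₐ h^{a,i−a} h^{c−a,c−i+a} = 0`, Deligne's convolution of Hodge numbers, the tree's `BettiUniverse.hodgeNumber_kunnethSummand`) OR if it is
supported in codimension `≥ c − 1` (Voisin 2013 Lemma 2.1 on the tree's carriers, `BettiUniverse.ofRatClass_crossMap_mem_algebraicClasses_of_supportedClasses_eq_top`: coniveau `r` on `Hⁱ(T)`,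
`s` on `Hʲ(T')`, `c − 1 ≤ r + s`; `N⁰ = everything`, so `H¹ ⊗ H'³` needs only `N¹H³(T') = H³(T')` — NO irregularity hypothesis — and `H³ ⊗ H'³` needs `N¹H³` on both).  Consequences: the coniveau
criterion WITHOUT `q = q' = 0` (§3: `N¹H³ = H³` on both and `h^{2,0}(T)h^{2,0}(T') = 0`), hence (Bloch–Srinivas, the tree's `supportedClasses_eq_top_of_hasChowZeroSupportedInDimLE_of_lt` and
`BettiUniverse.hodgeNumber_eq_zero_of_hasChowZeroSupportedInDimLE_of_lt`) **`HC(T × T')` for any two threefolds whose `CH₀` is supported on a SURFACE (e.g. uniruled threefolds) as soon as one of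
`h^{2,0}(T)`, `h^{2,0}(T')` vanishes**, in particular when `CH₀(T')` is supported on a CURVE, when `T'` is rationally chain connected (Fano threefolds, granted Kollár–Miyaoka–Mori), or when `T'` is a
smooth hypersurface of degree `≤ 4` in `ℙ⁴` — `T` being ANY threefold with `CH₀` on a surface, of any irregularity and any `h^{2,0}` (e.g. `ℙ¹ × S` for every surface `S`).  The tree's
`hodgeConjectureFor_tensor_threefolds_of_chowRankLEOneUpTo_zero` (both `CH₀` of rank `≤ 1`) and `IsSmoothHypersurface.hodgeConjectureFor_tensor_threefolds_of_degree_le_four` are the special cases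
with both factors at the bottom of this scale.

WHAT IS PROVED.
* §1 **`BettiUniverse.hodgeClasses_kunnethSummand_eq_bot_of_forall_hodgeNumber_mul_eq_zero`** (any `Y`, `Z`: `Σₐ h^{a,i−a}(HⁱY)·h^{c−a,c−i+a}(HʲZ) = 0` termwise ⟹ `Hdg^c(HⁱY ⊗ HʲZ) = 0`) and
  **`BettiUniverse.forall_ofRatClass_crossMap_mem_algebraicClasses_of_forall_hodgeNumber_mul_eq_zero`** (then the piece's cross products are — vacuously — algebraic).
* §2 **`BettiUniverse.hodgeConjectureFor_tensor_threefolds_of_hodgeNumber_or_supportedClasses`**: `HC(T × T')` from [`h^{1,0}h'^{2,1} = 0` or `N¹H³(T') = H³(T')`], [`h^{2,1}h'^{1,0} = 0` or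
  `N¹H³(T) = H³(T)`], `h^{2,0}h'^{2,0} = 0`, [(`h^{3,0}h'^{3,0} = 0` and `h^{2,1}h'^{2,1} = 0`) or (`N¹H³(T) = H³(T)` and `N¹H³(T') = H³(T')`)].
* §3 **`BettiUniverse.hodgeConjectureFor_tensor_threefolds_of_supportedClasses_three_eq_top`** (`N¹H³ = H³` twice, `h^{2,0}h'^{2,0} = 0`),
  **`hodgeConjectureFor_tensor_threefolds_of_hasChowZeroSupportedInDimLE_two`** (`CH₀` on surfaces twice, `h^{2,0}h'^{2,0} = 0`), **`…_two_one`** / **`…_one_two`** (`CH₀` on a surface and on a curve —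
  NO Hodge-number hypothesis, no instance hypothesis, no Hodge-model hypothesis), **`…_two_of_isRationallyChainConnected`**, **`…_two_of_isFano`** (granted the printed fact
  `KollarMiyaokaMori1992_fano_rationallyChainConnected`), **`IsSmoothHypersurface.hodgeConjectureFor_threefold_tensor_of_degree_le_four_of_hasChowZeroSupportedInDimLE_two`** and its mirror.

THE PRINTS.  C. Voisin (2002) [VoisinHodgeI2002] §7.1.1; §11.3.1 Thm. 11.30; §11.3.3 Thm. 11.38–11.40, Lemma 11.41 and pp. 285–287.  C. Voisin (2003) [VoisinHodgeII2003] §10.2.2 Thm. 10.17, Cor. 10.18, Cor. 10.21; §10.3.1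
Thm. 10.31; §9.2.4 Prop. 9.20.  S. Bloch, V. Srinivas (1983) [BlochSrinivas1983] Thm. 1.  C. Voisin (2013) [Voisin2013GHCBloch] Lemma 2.1 (proof).  P. Deligne (1971) [DeligneHodgeII1971] 1.2.5, 2.1.13.
J. Kollár, Y. Miyaoka, S. Mori (1992) [KollarMiyaokaMori1992] Thm. 3.3.  P. Deligne (2000/2006) [Deligne2000] §1.

THE OBJECTS (all the tree's).  `BettiUniverse.kunnethSummand`, `BettiUniverse.crossMap`, `BettiUniverse.hodge`, `HodgeStructure.hodgeNumber`, `hodgeClasses`, `supportedClasses`, `algebraicClasses`,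
`ofRatClass`, `HodgeConjectureFor`, `Barriers.HodgeConjecture.HasChowZeroSupportedInDimLE`, `IsRationallyChainConnected`, `IsFano`, `Motives.IsSmoothHypersurface 3 e`; the tree's
`BettiUniverse.hodgeConjectureFor_tensor_threefolds_of_kunneth_pieces`, `BettiUniverse.ofRatClass_crossMap_mem_algebraicClasses_of_supportedClasses_eq_top`, `…_of_hodgeClasses_eq_top_left/right`,
`BettiUniverse.hodgeNumber_kunnethSummand`, `HodgeStructure.hodgeClasses_eq_bot_of_hodgeNumber_eq_zero`, `supportedClasses_zero`, `supportedClasses_eq_top_of_hasChowZeroSupportedInDimLE_of_lt`,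
`BettiUniverse.hodgeNumber_eq_zero_of_hasChowZeroSupportedInDimLE_of_lt`, `IsRationallyChainConnected.hasChowZeroSupportedInDimLE_zero`, `IsSmoothHypersurface.hasChowZeroSupportedInDimLE_of_degree_le_succ`,
`hodgeTensorFacts_holds`, `exists_isReal_hodgeModel_holds`, `IsSmoothProjective.tensor_holds`.

DEVIATIONS / SCOPE.  Complex orientations (through the tree's supported-classes and Künneth-piece lemmas).  §1–§3 first halves keep `[HodgeTensorFacts.{0,0}]` and the Hodge model `hHD` where Hodge
numbers enter the hypotheses; the `CH₀`-only statements discharge both.  No definitions.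

## References
* [VoisinHodgeI2002] C. Voisin, *Hodge Theory and Complex Algebraic Geometry I* (2002) — §7.1.1; §11.3.1 Thm. 11.30; §11.3.3 Thm. 11.38–11.40, Lemma 11.41, pp. 285–287.
* [VoisinHodgeII2003] C. Voisin, *Hodge Theory and Complex Algebraic Geometry II* (2003) — §9.2.4 Prop. 9.20; §10.2.2 Thm. 10.17, Cor. 10.18, Cor. 10.21; §10.3.1 Thm. 10.31.
* [BlochSrinivas1983] S. Bloch, V. Srinivas, Remarks on correspondences and algebraic cycles, Amer. J. Math. 105 (1983) — Thm. 1.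
* [Voisin2013GHCBloch] C. Voisin, The generalized Hodge and Bloch conjectures are equivalent for general complete intersections (2013) — Lemma 2.1.
* [DeligneHodgeII1971] P. Deligne, *Théorie de Hodge II* (1971) — 1.2.5, 2.1.13.
* [KollarMiyaokaMori1992] J. Kollár, Y. Miyaoka, S. Mori, Rational connectedness and boundedness of Fano manifolds (1992) — Thm. 3.3.
* [Deligne2000] P. Deligne, *The Hodge conjecture* (Clay problem description) — §1.

## Provenance
Lane `lit-hodgefound` (Hodge path, Track 2), prover seat `lit-hodgefound-p29` (generation 33), self-proposed row g33-#3 (the hybrid of the seat's numerical criterion g33-#1 with the tree's coniveau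
criterion for `T × T'`, and its `CH₀` corollaries).
-/

noncomputable section

open scoped TensorProduct
open CategoryTheory MonoidalCategory CartesianMonoidalCategory Module Finset
open Literature.AlgebraicTopology.SingularHomology
open Literature.Geometry.Kaehler
open Literature.Barriers.HodgeConjecture

namespace Literature.AlgebraicGeometry.HodgeTheory

open Literature.AlgebraicGeometry.Motives
open Literature.AlgebraicGeometry.Motives.HodgeStructure

variable {m n : ℕ} {Y Z T T' : SchemeOver ℂ}

section Hodge

variable [HodgeTensorFacts.{0, 0}]

/-! ### §1 A Künneth piece with Hodge-disjoint factors carries no Hodge class -/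

/-- **`Hdg^c(Hⁱ(Y) ⊗ Hʲ(Z)) = 0` when no Hodge type of `Hⁱ(Y)` and of `Hʲ(Z)` add up to `(c, c)`**: if `h^{a,i−a}(HⁱY) · h^{c−a, c−(i−a)}(HʲZ) = 0` for every `0 ≤ a ≤ i`, then `h^{c,c}(HⁱY ⊗ HʲZ) =
Σₐ h^{a,i−a}(HⁱY) h^{c−a,c−i+a}(HʲZ) = 0` (Deligne's convolution, the tree's `BettiUniverse.hodgeNumber_kunnethSummand`) and `dim_ℚ Hdg^c ≤ h^{c,c}` (the tree's
`HodgeStructure.hodgeClasses_eq_bot_of_hodgeNumber_eq_zero`). [cite: DeligneHodgeII1971, 1.2.5 and 2.1.13] [cite: VoisinHodgeI2002, §7.1.1 and §11.3.3 Def. 11.39, pp. 285–287] -/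
theorem BettiUniverse.hodgeClasses_kunnethSummand_eq_bot_of_forall_hodgeNumber_mul_eq_zero (hHD : exists_isReal_hodgeModel) (hY : IsSmoothProjective m Y) (hZ : IsSmoothProjective n Z)
    {i j c : ℕ} (hij : i + j = 2 * c)
    (h : ∀ a : ℕ, a ≤ i → (BettiUniverse.hodge hHD hY i).hodgeNumber a (i - a : ℕ) * (BettiUniverse.hodge hHD hZ j).hodgeNumber ((c : ℤ) - a) ((c : ℤ) - (i - a : ℕ)) = 0) :
    (BettiUniverse.kunnethSummand hHD hY hZ (2 * c) ⟨(i, j), HasAntidiagonal.mem_antidiagonal.2 hij⟩).hodgeClasses c = ⊥ := by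
  haveI := BettiUniverse.finite hY i
  haveI := BettiUniverse.finite hZ j
  refine HodgeStructure.hodgeClasses_eq_bot_of_hodgeNumber_eq_zero _ (by push_cast; ring) ?_
  rw [BettiUniverse.hodgeNumber_kunnethSummand]
  exact Finset.sum_eq_zero fun a ha ↦ h a (by simpa using ha)

/-- Hence the cross products of the Hodge classes of such a piece are (vacuously) ALGEBRAIC — the per-piece obligation of the tree's Künneth-piece assemblies. [cite: DeligneHodgeII1971, 1.2.5]
[cite: VoisinHodgeI2002, §11.3.3 Thm. 11.38, Lemma 11.41 and pp. 285–287] -/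
theorem BettiUniverse.forall_ofRatClass_crossMap_mem_algebraicClasses_of_forall_hodgeNumber_mul_eq_zero (hHD : exists_isReal_hodgeModel) (hY : IsSmoothProjective m Y)
    (hZ : IsSmoothProjective n Z) {i j c : ℕ} (hij : i + j = 2 * c)
    (h : ∀ a : ℕ, a ≤ i → (BettiUniverse.hodge hHD hY i).hodgeNumber a (i - a : ℕ) * (BettiUniverse.hodge hHD hZ j).hodgeNumber ((c : ℤ) - a) ((c : ℤ) - (i - a : ℕ)) = 0) :
    ∀ t ∈ (BettiUniverse.kunnethSummand hHD hY hZ (2 * c) ⟨(i, j), HasAntidiagonal.mem_antidiagonal.2 hij⟩).hodgeClasses c,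
      ofRatClass (ComplexPoints (Y ⊗ Z)) (2 * c) (BettiUniverse.crossMap Y Z hij t) ∈ algebraicClasses (Y ⊗ Z) c := by
  intro t ht
  obtain rfl : t = 0 := (Submodule.mem_bot ℚ).1 ((BettiUniverse.hodgeClasses_kunnethSummand_eq_bot_of_forall_hodgeNumber_mul_eq_zero hHD hY hZ hij h).le ht)
  rw [map_zero, map_zero]
  exact Submodule.zero_mem _

/-! ### §2 The hybrid criterion for two threefolds -/

/-- **`HC(T × T')` for two smooth projective threefolds, piece by piece by Hodge numbers OR coniveau.**  Assume: [`h^{1,0}(T)·h^{2,1}(T') = 0` or `N¹H³(T') = H³(T')`] (the piece `H¹ ⊗ H'³`);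
[`h^{2,1}(T)·h^{1,0}(T') = 0` or `N¹H³(T) = H³(T)`] (`H³ ⊗ H'¹`); `h^{2,0}(T)·h^{2,0}(T') = 0` (`H² ⊗ H'²`: one factor consists of divisor classes); [(`h^{3,0}(T)h^{3,0}(T') = 0` and
`h^{2,1}(T)h^{2,1}(T') = 0`) or (`N¹H³(T) = H³(T)` and `N¹H³(T') = H³(T')`)] (`H³ ⊗ H'³`).  Then `HC(T × T')`.  A Hodge-disjoint piece carries no Hodge class (§1); a piece `Hⁱ ⊗ H'ʲ ⊂ H^{2c}` with
`Hⁱ(T) = NʳHⁱ`, `Hʲ(T') = NˢHʲ`, `c − 1 ≤ r + s` has algebraic Hodge classes (Voisin 2013 Lemma 2.1 on the tree's carriers; `N⁰ = everything`); `HC(T)`, `HC(T')` hold in dimension `3`.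
[cite: VoisinHodgeI2002, §7.1.1, §11.3.3 Thm. 11.38–11.40, Lemma 11.41 and pp. 285–287, §11.3.1 Thm. 11.30] [cite: Voisin2013GHCBloch, Lemma 2.1 (proof)] [cite: DeligneHodgeII1971, 1.2.5 and 2.1.13] [cite: VoisinHodgeII2003, §9.2.4 Prop. 9.20]
[cite: Deligne2000, §1] -/
theorem BettiUniverse.hodgeConjectureFor_tensor_threefolds_of_hodgeNumber_or_supportedClasses (hHD : exists_isReal_hodgeModel) (hT : IsSmoothProjective 3 T) (hT' : IsSmoothProjective 3 T')
    (hTT' : IsSmoothProjective 6 (T ⊗ T'))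
    (A13 : (BettiUniverse.hodge hHD hT 1).hodgeNumber 1 0 * (BettiUniverse.hodge hHD hT' 3).hodgeNumber 2 1 = 0 ∨ supportedClasses T' 3 1 = ⊤)
    (A31 : (BettiUniverse.hodge hHD hT 3).hodgeNumber 2 1 * (BettiUniverse.hodge hHD hT' 1).hodgeNumber 1 0 = 0 ∨ supportedClasses T 3 1 = ⊤)
    (A22 : (BettiUniverse.hodge hHD hT 2).hodgeNumber 2 0 * (BettiUniverse.hodge hHD hT' 2).hodgeNumber 2 0 = 0)
    (A33 : ((BettiUniverse.hodge hHD hT 3).hodgeNumber 3 0 * (BettiUniverse.hodge hHD hT' 3).hodgeNumber 3 0 = 0 ∧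
        (BettiUniverse.hodge hHD hT 3).hodgeNumber 2 1 * (BettiUniverse.hodge hHD hT' 3).hodgeNumber 2 1 = 0) ∨
      (supportedClasses T 3 1 = ⊤ ∧ supportedClasses T' 3 1 = ⊤)) :
    HodgeConjectureFor 6 (T ⊗ T') := by
  have hHC : HodgeConjectureFor 3 T := hodgeConjectureFor_of_dim_le_three_holds le_rfl hT
  have hHC' : HodgeConjectureFor 3 T' := hodgeConjectureFor_of_dim_le_three_holds le_rfl hT'
  -- Hodge classes of the factors are algebraic (dimension `3`)
  have halgT : ∀ (p : ℕ), ∀ z ∈ (BettiUniverse.hodge hHD hT (2 * p)).hodgeClasses (p : ℤ), ofRatClass (ComplexPoints T) (2 * p) z ∈ algebraicClasses T p :=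
    fun p z hz ↦ hHC.2 p _ (isRationalClass_ofRatClass _) ((BettiUniverse.mem_hodgeClasses_hodge_iff_isOfHodgeType hHD hT p z).1 hz)
  have halgT' : ∀ (p : ℕ), ∀ z ∈ (BettiUniverse.hodge hHD hT' (2 * p)).hodgeClasses (p : ℤ), ofRatClass (ComplexPoints T') (2 * p) z ∈ algebraicClasses T' p :=
    fun p z hz ↦ hHC'.2 p _ (isRationalClass_ofRatClass _) ((BettiUniverse.mem_hodgeClasses_hodge_iff_isOfHodgeType hHD hT' p z).1 hz)
  refine BettiUniverse.hodgeConjectureFor_tensor_threefolds_of_kunneth_pieces hHD hT hT' hTT' ?_ ?_ ?_ ?_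
  · -- `H¹(T) ⊗ H³(T')`
    rcases A13 with h | h
    · refine BettiUniverse.forall_ofRatClass_crossMap_mem_algebraicClasses_of_forall_hodgeNumber_mul_eq_zero hHD hT hT' (by norm_num) fun a ha ↦ ?_
      interval_cases a
      · -- `h^{0,1}(T) · h^{2,1}(T')`
        have key := h
        rw [BettiUniverse.hodgeNumber_hodge_symm hHD hT 1 (1 : ℤ) 0] at key
        convert key using 3 <;> norm_num
      · -- `h^{1,0}(T) · h^{1,2}(T')`
        have key := h
        rw [BettiUniverse.hodgeNumber_hodge_symm hHD hT' 3 (2 : ℤ) 1] at key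
        convert key using 3 <;> norm_num
    · exact fun t ht ↦ BettiUniverse.ofRatClass_crossMap_mem_algebraicClasses_of_supportedClasses_eq_top hHD hT hT' hTT' (i := 1) (j := 3) (p := 1) (r := 0) (s := 1)
        (by norm_num) (by norm_num) (supportedClasses_zero T 1) h ht
  · -- `H²(T) ⊗ H²(T')`: one factor consists of divisor classes
    rcases mul_eq_zero.1 A22 with h | h
    · have htop : (BettiUniverse.hodge hHD hT (2 * 1)).hodgeClasses (1 : ℕ) = ⊤ := (BettiUniverse.hodgeClasses_hodge_two_eq_top_iff hHD hT).2 h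
      have halgT2 : ∀ u : bettiCohomology T (2 * 1), ofRatClass (ComplexPoints T) (2 * 1) u ∈ algebraicClasses T 1 :=
        fun u ↦ halgT 1 u (by rw [htop]; exact Submodule.mem_top)
      intro t ht
      exact BettiUniverse.ofRatClass_crossMap_mem_algebraicClasses_of_hodgeClasses_eq_top_left hHD hT hT' (a := 1) (b := 1) (c := 2) (by norm_num) htop halgT2 (halgT' 1) ht
    · have htop' : (BettiUniverse.hodge hHD hT' (2 * 1)).hodgeClasses (1 : ℕ) = ⊤ := (BettiUniverse.hodgeClasses_hodge_two_eq_top_iff hHD hT').2 h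
      have halgT'2 : ∀ w : bettiCohomology T' (2 * 1), ofRatClass (ComplexPoints T') (2 * 1) w ∈ algebraicClasses T' 1 :=
        fun w ↦ halgT' 1 w (by rw [htop']; exact Submodule.mem_top)
      intro t ht
      exact BettiUniverse.ofRatClass_crossMap_mem_algebraicClasses_of_hodgeClasses_eq_top_right hHD hT hT' (a := 1) (b := 1) (c := 2) (by norm_num) htop' (halgT 1) halgT'2 ht
  · -- `H³(T) ⊗ H¹(T')`
    rcases A31 with h | h
    · refine BettiUniverse.forall_ofRatClass_crossMap_mem_algebraicClasses_of_forall_hodgeNumber_mul_eq_zero hHD hT hT' (by norm_num) fun a ha ↦ ?_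
      interval_cases a
      · -- `(0,3)` against `(2,−1)`
        exact mul_eq_zero_of_right _ (BettiUniverse.hodgeNumber_hodge_eq_zero_of_neg_right hHD hT' 1 _ (by norm_num))
      · -- `h^{1,2}(T) · h^{1,0}(T')`
        have key := h
        rw [BettiUniverse.hodgeNumber_hodge_symm hHD hT 3 (2 : ℤ) 1] at key
        convert key using 3 <;> norm_num
      · -- `h^{2,1}(T) · h^{0,1}(T')`
        have key := h
        rw [BettiUniverse.hodgeNumber_hodge_symm hHD hT' 1 (1 : ℤ) 0] at key
        convert key using 3 <;> norm_num
      · -- `(3,0)` against `(−1,2)`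
        exact mul_eq_zero_of_right _ (BettiUniverse.hodgeNumber_hodge_eq_zero_of_neg_left hHD hT' 1 _ (by norm_num))
    · exact fun t ht ↦ BettiUniverse.ofRatClass_crossMap_mem_algebraicClasses_of_supportedClasses_eq_top hHD hT hT' hTT' (i := 3) (j := 1) (p := 1) (r := 1) (s := 0)
        (by norm_num) (by norm_num) h (supportedClasses_zero T' 1) ht
  · -- `H³(T) ⊗ H³(T')`
    rcases A33 with ⟨h30, h21⟩ | ⟨h3, h3'⟩
    · refine BettiUniverse.forall_ofRatClass_crossMap_mem_algebraicClasses_of_forall_hodgeNumber_mul_eq_zero hHD hT hT' (by norm_num) fun a ha ↦ ?_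
      interval_cases a
      · -- `h^{0,3}(T) · h^{3,0}(T')`
        have key := h30
        rw [BettiUniverse.hodgeNumber_hodge_symm hHD hT 3 (3 : ℤ) 0] at key
        convert key using 3 <;> norm_num
      · -- `h^{1,2}(T) · h^{2,1}(T')`
        have key := h21
        rw [BettiUniverse.hodgeNumber_hodge_symm hHD hT 3 (2 : ℤ) 1] at key
        convert key using 3 <;> norm_num
      · -- `h^{2,1}(T) · h^{1,2}(T')`
        have key := h21
        rw [BettiUniverse.hodgeNumber_hodge_symm hHD hT' 3 (2 : ℤ) 1] at key
        convert key using 3 <;> norm_num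
      · -- `h^{3,0}(T) · h^{0,3}(T')`
        have key := h30
        rw [BettiUniverse.hodgeNumber_hodge_symm hHD hT' 3 (3 : ℤ) 0] at key
        convert key using 3 <;> norm_num
    · exact fun t ht ↦ BettiUniverse.ofRatClass_crossMap_mem_algebraicClasses_of_supportedClasses_eq_top hHD hT hT' hTT' (i := 3) (j := 3) (p := 2) (r := 1) (s := 1)
        (by norm_num) (by norm_num) h3 h3' ht

/-! ### §3 Coniveau without irregularity hypotheses; `CH₀` supported on surfaces and curves -/

/-- **`HC(T × T')` for two smooth projective threefolds with `N¹H³(T) = H³(T)`, `N¹H³(T') = H³(T')` and `h^{2,0}(T)·h^{2,0}(T') = 0`** — the tree's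
`BettiUniverse.hodgeConjectureFor_tensor_threefolds_of_q_zero_of_h20_zero_of_supportedClasses_three_eq_top` WITHOUT its hypotheses `q(T) = q(T') = 0` (the pieces `H¹ ⊗ H'³`, `H³ ⊗ H'¹` are
supported in codimension `≥ 1 = c − 1` as soon as the `H³`-factor is). [cite: Voisin2013GHCBloch, Lemma 2.1 (proof)] [cite: VoisinHodgeI2002, §11.3.3 Thm. 11.38, Lemma 11.41 and p. 287, §11.3.1 Thm. 11.30] [cite: Deligne2000, §1] -/
theorem BettiUniverse.hodgeConjectureFor_tensor_threefolds_of_supportedClasses_three_eq_top (hHD : exists_isReal_hodgeModel) (hT : IsSmoothProjective 3 T) (hT' : IsSmoothProjective 3 T')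
    (hTT' : IsSmoothProjective 6 (T ⊗ T')) (h3 : supportedClasses T 3 1 = ⊤) (h3' : supportedClasses T' 3 1 = ⊤)
    (h20 : (BettiUniverse.hodge hHD hT 2).hodgeNumber 2 0 * (BettiUniverse.hodge hHD hT' 2).hodgeNumber 2 0 = 0) : HodgeConjectureFor 6 (T ⊗ T') :=
  BettiUniverse.hodgeConjectureFor_tensor_threefolds_of_hodgeNumber_or_supportedClasses hHD hT hT' hTT' (Or.inr h3') (Or.inr h3) h20 (Or.inr ⟨h3, h3'⟩)

/-- **`HC(T × T')` for two smooth projective threefolds whose `CH₀` are supported on SURFACES** (closed algebraic subsets of dimension `≤ 2`; e.g. uniruled threefolds) **with `h^{2,0}(T)·h^{2,0}(T') = 0`**: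
Bloch–Srinivas gives `N¹H³ = H³` on both (the tree's `supportedClasses_three_one_eq_top_of_hasChowZeroSupportedInDimLE_two`). [cite: BlochSrinivas1983, Thm. 1] [cite: VoisinHodgeII2003, §10.2.2 Thm. 10.17 and Cor. 10.21]
[cite: Voisin2013GHCBloch, Lemma 2.1 (proof)] [cite: VoisinHodgeI2002, §11.3.3 Thm. 11.38, Lemma 11.41 and p. 287] [cite: Deligne2000, §1] -/
theorem hodgeConjectureFor_tensor_threefolds_of_hasChowZeroSupportedInDimLE_two (hHD : exists_isReal_hodgeModel) (hT : IsSmoothProjective 3 T) (hT' : IsSmoothProjective 3 T')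
    (hW : HasChowZeroSupportedInDimLE T 2) (hW' : HasChowZeroSupportedInDimLE T' 2)
    (h20 : (BettiUniverse.hodge hHD hT 2).hodgeNumber 2 0 * (BettiUniverse.hodge hHD hT' 2).hodgeNumber 2 0 = 0) : HodgeConjectureFor (3 + 3) (T ⊗ T') :=
  BettiUniverse.hodgeConjectureFor_tensor_threefolds_of_supportedClasses_three_eq_top hHD hT hT' (hT.tensor_holds hT')
    (supportedClasses_three_one_eq_top_of_hasChowZeroSupportedInDimLE_two hT hW) (supportedClasses_three_one_eq_top_of_hasChowZeroSupportedInDimLE_two hT' hW') h20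

end Hodge

/-- **`HC(T × T')` for a smooth projective threefold `T` whose `CH₀` is supported on a SURFACE and a smooth projective threefold `T'` whose `CH₀` is supported on a CURVE — unconditionally, with no
Hodge-number hypothesis** (`h^{2,0}(T') = 0` by Bloch–Srinivas, the tree's `BettiUniverse.hodgeNumber_eq_zero_of_hasChowZeroSupportedInDimLE_of_lt`; the standing tensor facts and the real Hodge
model are theorems of the tree).  `T` may have any irregularity and any `h^{2,0}` (e.g. `ℙ¹ × S` for an arbitrary surface `S`, once its `CH₀` is moved onto a surface). [cite: BlochSrinivas1983, Thm. 1]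
[cite: VoisinHodgeII2003, §10.2.2 Thm. 10.17, Cor. 10.18 and Cor. 10.21] [cite: Voisin2013GHCBloch, Lemma 2.1 (proof)] [cite: VoisinHodgeI2002, §11.3.3 Thm. 11.38, Lemma 11.41 and p. 287] [cite: Deligne2000, §1] -/
theorem hodgeConjectureFor_tensor_threefolds_of_hasChowZeroSupportedInDimLE_two_one (hT : IsSmoothProjective 3 T) (hT' : IsSmoothProjective 3 T') (hW : HasChowZeroSupportedInDimLE T 2)
    (hW' : HasChowZeroSupportedInDimLE T' 1) : HodgeConjectureFor (3 + 3) (T ⊗ T') := by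
  haveI : HodgeTensorFacts.{0, 0} := hodgeTensorFacts_holds
  have h20' := (BettiUniverse.hodgeNumber_eq_zero_of_hasChowZeroSupportedInDimLE_of_lt exists_isReal_hodgeModel_holds hT' hW' (k := 2) (by norm_num)).2
  exact hodgeConjectureFor_tensor_threefolds_of_hasChowZeroSupportedInDimLE_two exists_isReal_hodgeModel_holds hT hT' hW (hW'.mono (by norm_num))
    (mul_eq_zero_of_right _ (by simpa using h20'))

/-- Mirror: **`HC(T × T')` for `CH₀(T)` supported on a curve and `CH₀(T')` supported on a surface.** [cite: BlochSrinivas1983, Thm. 1] [cite: VoisinHodgeII2003, §10.2.2 Thm. 10.17, Cor. 10.18 and Cor. 10.21] [cite: Voisin2013GHCBloch, Lemma 2.1 (proof)]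
[cite: Deligne2000, §1] -/
theorem hodgeConjectureFor_tensor_threefolds_of_hasChowZeroSupportedInDimLE_one_two (hT : IsSmoothProjective 3 T) (hT' : IsSmoothProjective 3 T') (hW : HasChowZeroSupportedInDimLE T 1)
    (hW' : HasChowZeroSupportedInDimLE T' 2) : HodgeConjectureFor (3 + 3) (T ⊗ T') := by
  haveI : HodgeTensorFacts.{0, 0} := hodgeTensorFacts_holds
  have h20 := (BettiUniverse.hodgeNumber_eq_zero_of_hasChowZeroSupportedInDimLE_of_lt exists_isReal_hodgeModel_holds hT hW (k := 2) (by norm_num)).2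
  exact hodgeConjectureFor_tensor_threefolds_of_hasChowZeroSupportedInDimLE_two exists_isReal_hodgeModel_holds hT hT' (hW.mono (by norm_num)) hW'
    (mul_eq_zero_of_left (by simpa using h20) _)

/-- **`HC(T × T')` for `CH₀(T)` supported on a surface and `T'` RATIONALLY CHAIN CONNECTED** (`CH₀(T') = ℤ`, the tree's `IsRationallyChainConnected.hasChowZeroSupportedInDimLE_zero`).
[cite: BlochSrinivas1983, Thm. 1] [cite: VoisinHodgeII2003, §10.2.2 Thm. 10.17 and Cor. 10.18] [cite: Voisin2013GHCBloch, Lemma 2.1 (proof)] [cite: Deligne2000, §1] -/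
theorem hodgeConjectureFor_tensor_threefolds_of_hasChowZeroSupportedInDimLE_two_of_isRationallyChainConnected (hT : IsSmoothProjective 3 T) (hT' : IsSmoothProjective 3 T')
    (hW : HasChowZeroSupportedInDimLE T 2) (hRC : IsRationallyChainConnected T') : HodgeConjectureFor (3 + 3) (T ⊗ T') :=
  hodgeConjectureFor_tensor_threefolds_of_hasChowZeroSupportedInDimLE_two_one hT hT' hW ((hRC.hasChowZeroSupportedInDimLE_zero hT').mono (by norm_num))

/-- **`HC(T × F)` for `CH₀(T)` supported on a surface and `F` a FANO threefold, granted the printed fact `KollarMiyaokaMori1992_fano_rationallyChainConnected`** (Fano manifolds are rationally chain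
connected). [cite: KollarMiyaokaMori1992, Thm. 3.3] [cite: BlochSrinivas1983, Thm. 1] [cite: Voisin2013GHCBloch, Lemma 2.1 (proof)] [cite: Deligne2000, §1] -/
theorem hodgeConjectureFor_tensor_threefolds_of_hasChowZeroSupportedInDimLE_two_of_isFano (hKMM : KollarMiyaokaMori1992_fano_rationallyChainConnected) (hT : IsSmoothProjective 3 T)
    {F : SchemeOver ℂ} (hF : IsFano 3 F) (hW : HasChowZeroSupportedInDimLE T 2) : HodgeConjectureFor (3 + 3) (T ⊗ F) :=
  hodgeConjectureFor_tensor_threefolds_of_hasChowZeroSupportedInDimLE_two_one hT hF.isSmoothProjective hW ((hKMM.hasChowZeroSupportedInDimLE_zero hF).mono (by norm_num))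

end Literature.AlgebraicGeometry.HodgeTheory

namespace Literature.AlgebraicGeometry.Motives.IsSmoothHypersurface

open Literature.AlgebraicGeometry.Motives
open Literature.AlgebraicGeometry.HodgeTheory
open Literature.Barriers.HodgeConjecture

variable {e : ℕ} {Y T : SchemeOver ℂ}

/-- **`HC(Y × T)` for a smooth hypersurface threefold `Y ⊂ ℙ⁴_ℂ` of degree `1 ≤ e ≤ 4` and ANY smooth projective threefold `T` whose `CH₀` is supported on a surface** — unconditionally (`CH₀(Y)` is
supported on a hyperplane section, the tree's `hasChowZeroSupportedInDimLE_of_degree_le_succ`; `h^{2,0}(Y) = 0` as `H²(Y;ℚ) = Hdg¹`, the tree's `hodgeClasses_hodge_eq_top_of_two_mul_ne`).  The tree's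
`hodgeConjectureFor_tensor_threefolds_of_degree_le_four` is the case where `T` is such a hypersurface too. [cite: BlochSrinivas1983, Thm. 1] [cite: VoisinHodgeII2003, §10.3.1 Thm. 10.31, §10.2.2 Thm. 10.17 and §1.2.3 Cor. 1.24–1.25]
[cite: Voisin2013GHCBloch, Lemma 2.1 (proof)] [cite: VoisinHodgeI2002, §11.3.3 Thm. 11.38, Lemma 11.41 and p. 287] [cite: Deligne2000, §1] -/
theorem hodgeConjectureFor_threefold_tensor_of_degree_le_four_of_hasChowZeroSupportedInDimLE_two (hY : IsSmoothHypersurface 3 e Y) (he : 0 < e) (he4 : e ≤ 4) (hT : IsSmoothProjective 3 T)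
    (hW : HasChowZeroSupportedInDimLE T 2) : HodgeConjectureFor (3 + 3) (Y ⊗ T) := by
  haveI : HodgeTensorFacts.{0, 0} := hodgeTensorFacts_holds
  have h20 : (BettiUniverse.hodge exists_isReal_hodgeModel_holds hY.1 2).hodgeNumber 2 0 = 0 :=
    (BettiUniverse.hodgeClasses_hodge_two_eq_top_iff exists_isReal_hodgeModel_holds hY.1).1 (hY.hodgeClasses_hodge_eq_top_of_two_mul_ne exists_isReal_hodgeModel_holds hY.1 (p := 1) (by norm_num))
  exact hodgeConjectureFor_tensor_threefolds_of_hasChowZeroSupportedInDimLE_two exists_isReal_hodgeModel_holds hY.1 hT (hY.hasChowZeroSupportedInDimLE_of_degree_le_succ (by norm_num) he he4) hW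
    (mul_eq_zero_of_left h20 _)

/-- Mirror: **`HC(T × Y)`**, `CH₀(T)` supported on a surface, `Y ⊂ ℙ⁴` smooth of degree `1 ≤ e ≤ 4`. [cite: BlochSrinivas1983, Thm. 1] [cite: VoisinHodgeII2003, §10.3.1 Thm. 10.31 and §10.2.2 Thm. 10.17] [cite: Voisin2013GHCBloch, Lemma 2.1 (proof)]
[cite: Deligne2000, §1] -/
theorem hodgeConjectureFor_tensor_threefold_of_degree_le_four_of_hasChowZeroSupportedInDimLE_two (hY : IsSmoothHypersurface 3 e Y) (he : 0 < e) (he4 : e ≤ 4) (hT : IsSmoothProjective 3 T)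
    (hW : HasChowZeroSupportedInDimLE T 2) : HodgeConjectureFor (3 + 3) (T ⊗ Y) := by
  haveI : HodgeTensorFacts.{0, 0} := hodgeTensorFacts_holds
  have h20 : (BettiUniverse.hodge exists_isReal_hodgeModel_holds hY.1 2).hodgeNumber 2 0 = 0 :=
    (BettiUniverse.hodgeClasses_hodge_two_eq_top_iff exists_isReal_hodgeModel_holds hY.1).1 (hY.hodgeClasses_hodge_eq_top_of_two_mul_ne exists_isReal_hodgeModel_holds hY.1 (p := 1) (by norm_num))
  exact hodgeConjectureFor_tensor_threefolds_of_hasChowZeroSupportedInDimLE_two exists_isReal_hodgeModel_holds hT hY.1 hW (hY.hasChowZeroSupportedInDimLE_of_degree_le_succ (by norm_num) he he4)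
    (mul_eq_zero_of_right _ h20)

end Literature.AlgebraicGeometry.Motives.IsSmoothHypersurface

end
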